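import Summits.QuantumFields.YangMills.Theorems.AllWindowsColdBoxBoxHighLineGaugeBallOfBootstrap
import Summits.QuantumFields.YangMills.Theorems.AllWindowsColdBoxBoxHighLineFPRepresentationPrelims
import Summits.QuantumFields.YangMills.Theorems.WeakCouplingRatesBulkDominatesColdBoxWDirKernelTwoPoint
import Summits.QuantumFields.YangMills.Theorems.WeakCouplingRatesColdBoxDirichletWick

/-!
# T-S5.13A, relative form — inputs: the rarity of `¬SmallPlaquettes` in the cold box and the signal floor of the Dirichlet surrogate
# (ASSEMBLY-S5 §1 «p» and §6 «SIGNAL FLOOR»; LINE-19 S5 ⟨stmt-QuantumFields-24004⟩/⟨24335⟩)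

Width seat `ym-line-sfw-p2-w2` (g31).  Two inputs of the conversion of ✓13A's absolute error `200(δ + p + τ)` into the relative error
`ε₁·(3/4)·boxDirCircSqCov` that ✓`landauRelativeComparisonBulk_of_split` consumes:

* `boxState_not_smallPlaquettes_le` — `P_box(¬SmallPlaquettes H spl) ≤ P_box(∃ p touching the box, spl² ≤ cost_p)`: the cold wall holds
  a.s. (✓`FPRep.ae_coldWall`) and a cold-wall configuration whose box-touching plaquettes all cost `< spl²` is in `SmallPlaquettes`
  (✓`smallPlaquettes_of_coldWall_of_good`); ★`exists_forall_boxState_not_smallPlaquettes_le` — with `spl = β^{ε₁ − 1/2}`, `H = ⌈β^θ⌉₊` and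
  **`2θ < ε₁`** (the entropy of the Gibbs union bound ✓`boxState_largeField_rarity` — this constraint is ABSENT from ASSEMBLY-S5 §1 and must be
  added there), `P_box(¬SP) ≤ exp(−β^{ε₁})` for `β ≥ β₀`;
* ★`boxDirCircSqCov_floor` — on the bulk window of ✓`boxDirichletPlaqCov_ge` (`H ≥ 32`, `M_D·T ≤ H/8`, `L_D ≤ T`):
  `3/(32π⁴)/T⁸ ≤ (3/4)·boxDirCircSqCov H T` (✓`boxDirCircSqCov_eq_two_mul_sq`), and `…/H⁸ ≤ …` (`boxDirCircSqCov_floor_H`).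

Everything proved, tree + Mathlib; no definitions; standard axioms.
HONEST LABEL: bookkeeping inputs for the T-S5.13 assembly of the XL stub S5 (`stub_landauSecondOrder`) of a critic-PASSed DRAFT line; S5, U5,
⟨24004⟩ ⟨24335⟩ ⟨24336⟩ remain OPEN; no stub is closed by name, no crux, rung or summit is proved; **the Yang–Mills mass gap is NOT proved by this file.**
-/

set_option autoImplicit false

noncomputable section

open MeasureTheory Real
open Literature.Probability.LatticeModels (Site)
open Literature.MathematicalPhysics.QuantumFieldTheory.AxialGauge (boxEdges)
open Literature.MathematicalPhysics.QuantumLattice (LGConfig fundamentalRep plaquettesTouching plaquetteObs)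
open Summit.QuantumFields.YangMills.Theorems.WeakCouplingRates (boxState plaqCostAt boxDirCircSqCov boxDirichletPlaqCov boxDirichletPlaqCov_ge
  boxDirCircSqCov_eq_two_mul_sq boxState_largeField_rarity)

namespace Summit.QuantumFields.YangMills.Theorems.AllWindowsColdBoxBoxHighLine

namespace BoxToChart

/-! ## The rarity of `¬SmallPlaquettes` -/

/-- `P_box(¬SmallPlaquettes H spl) ≤ P_box(∃ p touching the box, spl² ≤ 2 − Re tr U_p)` (cold wall a.s.). -/
theorem boxState_not_smallPlaquettes_le (β : ℝ) (H : ℕ) (spl : ℝ) :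
    (boxState (fundamentalRep (Fin 2)) β H) {U | ¬ SmallPlaquettes H spl U} ≤
      (boxState (fundamentalRep (Fin 2)) β H) {U | ∃ p ∈ plaquettesTouching (boxEdges 4 (2 * H + 1)),
        spl ^ 2 ≤ (2 : ℝ) - plaquetteObs (fundamentalRep (Fin 2)) p.1 p.2.1.1 p.2.1.2 U} := by
  refine measure_mono_ae ?_
  filter_upwards [FPRep.ae_coldWall β H] with U hU hnot
  by_contra h
  refine hnot (smallPlaquettes_of_coldWall_of_good hU fun p hp => ?_)
  by_contra h'
  refine h ⟨p, hp, ?_⟩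
  have h2 := not_lt.1 h'
  simp only [plaqCostAt, Nat.cast_ofNat] at h2
  exact h2

/-- ★ **`P_box(¬SP) ≤ exp(−β^{ε₁})`** for `spl = β^{ε₁ − 1/2}`, `H = ⌈β^θ⌉₊`, `0 < θ`, **`2θ < ε₁`**, `β ≥ β₀` (✓`boxState_largeField_rarity`). -/
theorem exists_forall_boxState_not_smallPlaquettes_le {θ ε₁ : ℝ} (hθ : 0 < θ) (hε : 2 * θ < ε₁) :
    ∃ β₀ : ℝ, 1 ≤ β₀ ∧ ∀ β : ℝ, β₀ ≤ β →
      ((boxState (fundamentalRep (Fin 2)) β ⌈β ^ θ⌉₊) {U | ¬ SmallPlaquettes ⌈β ^ θ⌉₊ (β ^ (ε₁ - 1 / 2)) U}).toReal ≤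
        Real.exp (-(β ^ ε₁)) := by
  obtain ⟨β₀, hβ₀⟩ := boxState_largeField_rarity hθ hε
  refine ⟨max β₀ 1, le_max_right _ _, fun β hβ => ?_⟩
  have hβ1 : 1 ≤ β := (le_max_right _ _).trans hβ
  have hβ0 : 0 < β := by linarith
  have h := hβ₀ β ((le_max_left _ _).trans hβ)
  have hsq : (β ^ (ε₁ - 1 / 2)) ^ 2 = β ^ (2 * ε₁ - 1) := by
    rw [← Real.rpow_natCast, ← Real.rpow_mul hβ0.le]
    norm_num
    ring_nf
  haveI := FPRep.isProbabilityMeasure_boxState β ⌈β ^ θ⌉₊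
  calc ((boxState (fundamentalRep (Fin 2)) β ⌈β ^ θ⌉₊) {U | ¬ SmallPlaquettes ⌈β ^ θ⌉₊ (β ^ (ε₁ - 1 / 2)) U}).toReal
      ≤ ((boxState (fundamentalRep (Fin 2)) β ⌈β ^ θ⌉₊) {U | ∃ p ∈ plaquettesTouching (boxEdges 4 (2 * ⌈β ^ θ⌉₊ + 1)),
          β ^ (2 * ε₁ - 1) ≤ (2 : ℝ) - plaquetteObs (fundamentalRep (Fin 2)) p.1 p.2.1.1 p.2.1.2 U}).toReal := by
        rw [← hsq]
        exact ENNReal.toReal_mono (measure_ne_top _ _) (boxState_not_smallPlaquettes_le β _ _)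
    _ ≤ Real.exp (-(β ^ ε₁)) := h

/-! ## The signal floor of the Dirichlet surrogate -/

/-- ★ **Signal floor**: on the bulk window of ✓`boxDirichletPlaqCov_ge` (`H ≥ 32`, `M·T ≤ H/8`, `L ≤ T`),
`3/(32π⁴)/T⁸ ≤ (3/4)·boxDirCircSqCov H T`. -/
theorem boxDirCircSqCov_floor : ∃ M L : ℝ, 1 ≤ M ∧ 1 ≤ L ∧ ∀ H : ℕ, (32 : ℝ) ≤ H → ∀ T : ℕ,
    M * (T : ℝ) ≤ (H : ℝ) / 8 → L ≤ (T : ℝ) → 3 / (32 * π ^ 4) / (T : ℝ) ^ 8 ≤ 3 / 4 * boxDirCircSqCov H T := by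
  obtain ⟨M, L, hM, hL, h⟩ := boxDirichletPlaqCov_ge
  refine ⟨M, L, hM, hL, fun H hH T hMT hLT => ?_⟩
  have hge := h H hH T hMT hLT
  have hT1 : (1 : ℝ) ≤ T := hL.trans hLT
  have hT0 : (0 : ℝ) < T := by linarith
  have h0 : 0 ≤ 1 / (4 * π ^ 2) / (T : ℝ) ^ 4 := by positivity
  rw [boxDirCircSqCov_eq_two_mul_sq]
  have hsq : (1 / (4 * π ^ 2) / (T : ℝ) ^ 4) ^ 2 ≤ boxDirichletPlaqCov H T ^ 2 := pow_le_pow_left₀ h0 hge 2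
  have e : 3 / (32 * π ^ 4) / (T : ℝ) ^ 8 = 3 / 4 * (2 * (1 / (4 * π ^ 2) / (T : ℝ) ^ 4) ^ 2) := by
    field_simp
    ring
  rw [e]
  exact mul_le_mul_of_nonneg_left (by linarith) (by norm_num)

/-- The same floor in terms of `H` (`T ≤ H` on the bulk window): `3/(32π⁴)/H⁸ ≤ (3/4)·boxDirCircSqCov H T`. -/
theorem boxDirCircSqCov_floor_H : ∃ M L : ℝ, 1 ≤ M ∧ 1 ≤ L ∧ ∀ H : ℕ, (32 : ℝ) ≤ H → ∀ T : ℕ,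
    M * (T : ℝ) ≤ (H : ℝ) / 8 → L ≤ (T : ℝ) → 3 / (32 * π ^ 4) / (H : ℝ) ^ 8 ≤ 3 / 4 * boxDirCircSqCov H T := by
  obtain ⟨M, L, hM, hL, h⟩ := boxDirCircSqCov_floor
  refine ⟨M, L, hM, hL, fun H hH T hMT hLT => (le_trans ?_ (h H hH T hMT hLT))⟩
  have hT1 : (1 : ℝ) ≤ T := hL.trans hLT
  have hT0 : (0 : ℝ) < T := by linarith
  have hTH : (T : ℝ) ≤ H := by
    have h1 : (T : ℝ) ≤ M * T := le_mul_of_one_le_left hT0.le hM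
    have h2 : (H : ℝ) / 8 ≤ H := by linarith
    linarith
  have hpow : (T : ℝ) ^ 8 ≤ (H : ℝ) ^ 8 := pow_le_pow_left₀ hT0.le hTH 8
  exact div_le_div_of_nonneg_left (by positivity) (by positivity) hpow

end BoxToChart

end Summit.QuantumFields.YangMills.Theorems.AllWindowsColdBoxBoxHighLine

end
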